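import Summits.QuantumFields.YangMills.Theorems.BalabanUVNodesN21SelectedThresholds

/-!
# YM-DAG node N21 (= NE7c) — ROW A″ VACUITY GUARD: the hypotheses of `shellWeightBound_geometric_of_selectedThresholds` (module 18b) are JOINTLY INHABITED by a
# non-degenerate toy whose slot law GENUINELY DEPENDS on the older thresholds (`hdep` exercised), with losses `M₁ = 2 ≠ M₂ = 1`, POSITIVE shell parts at every admissible
# assignment, and the selected-threshold conclusion FIRING with a positive geometric weight

Track A of `YM-PLAN.md` (cell `pub-ymgap`, HUMAN RULING D-0062), node **N21**; R134 fan-out seat `pub-ymgap-dag-n21-d` (s2), generation 4, module 18c (ROW A″ §4 of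
`LENS-nearmiss.md` v4.0).  THEOREMS ONLY: 0 `def`, 0 `sorry`, standard axioms; COUNT-NEUTRAL; `--supports` the K3′ item `SpineGivenEndpointR12` (stmt-QuantumFields-19908) as a
helper.  Imports module 18b only.  A TOY (one term, one slot per comparison at the top level, Lebesgue law on `[0,1]` scaled by `1 + (Σ_{i<K} a_i)²` — so comparison `K`'s law
reads EVERY older threshold and no younger one), NOT Bałaban's terms; it certifies that 18b's binder package excludes nothing by accident (A2), nothing more.

WHAT IS PROVED ([folklore]).  §1 toy measure facts (`toyLaw_apply`, `toyLaw_univ`, `toyLaw_shell`, `toyLaw_shell_le`); §2 **`selectedThresholds_fires`**: ∃ (law, sharp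
letters, assignment) with (i) the law of comparison `1` DIFFERENT at the older threshold `½` and `1` (older-measurability used non-trivially) yet older-measurable (`hdep`),
(ii) at EVERY admissible assignment positive weights and POSITIVE shell parts (no flat witness), (iii) an admissible assignment at which 18b §3's conclusion holds AT SHARP
CARRIERS with weight `C·(½)^K`, `C > 0` — obtained by APPLYING `shellWeightBound_geometric_of_selectedThresholds` to the toy (every one of its hypotheses discharged).
HONEST FRAMING: a guard; nothing of Bałaban's asserted; NE7c NOT PRINTED ∕ NOT PROVED; **N21 NOT discharged**; count-neutral; one finite 𝕋⁴ at fixed ε — NOT ℝ⁴ ∕ OS ∕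
mass gap ∕ Clay.  No decl below carries a cite tag.
-/

set_option autoImplicit false

noncomputable section

open scoped BigOperators ENNReal NNReal
open MeasureTheory Set

namespace Summit.QuantumFields.YangMills.Theorems.N21SelectedThresholdsSanity

open Literature.MathematicalPhysics.QuantumFieldTheory.Balaban1983to89
open Literature.MathematicalPhysics.QuantumFieldTheory.Balaban1983to89.T4ShellMeasure (SlotAntiConcentration)
open T4IndicatorShell (ShellWeightBound)
open T4ShellMeasureLevels (LevelLedger LiveWindow)
open T4ShellMeasureLevels.Toy (T S lvl liveWindow)
open N21SelectedThresholds (shellWeightBound_geometric_of_selectedThresholds)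

/-! ## §1 The toy law: Lebesgue on `[0,1]` scaled by `1 + (Σ_{i<K} a_i)²` -/

section ToyLaw

/-- the toy law of comparison `K` at assignment `a` applied to a measurable set. [folklore] -/
theorem toyLaw_apply (K : ℕ) (a : ℕ → ℝ) {E : Set ℝ} (hE : MeasurableSet E) :
    ((Real.toNNReal (1 + (∑ i ∈ Finset.range K, a i) ^ 2)) • (volume.restrict (Icc (0 : ℝ) 1))) E
      = ENNReal.ofReal (1 + (∑ i ∈ Finset.range K, a i) ^ 2) * volume (E ∩ Icc (0 : ℝ) 1) := by
  rw [Measure.smul_apply, Measure.restrict_apply hE, ENNReal.smul_def, smul_eq_mul]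
  rfl

/-- its total mass is `1 + (Σ_{i<K} a_i)²`. [folklore] -/
theorem toyLaw_univ (K : ℕ) (a : ℕ → ℝ) :
    (((Real.toNNReal (1 + (∑ i ∈ Finset.range K, a i) ^ 2)) • (volume.restrict (Icc (0 : ℝ) 1))) univ).toReal
      = 1 + (∑ i ∈ Finset.range K, a i) ^ 2 := by
  rw [toyLaw_apply K a MeasurableSet.univ, univ_inter, Real.volume_Icc, sub_zero, ENNReal.ofReal_one, mul_one,
    ENNReal.toReal_ofReal (by positivity)]

/-- the shell `{u(1 − ρ) ≤ x < u}` is the interval `Ico (u(1 − ρ)) u`. [folklore] -/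
theorem shell_eq_Ico (u ρ : ℝ) : {x : ℝ | u * (1 - ρ) ≤ x ∧ x < u} = Ico (u * (1 - ρ)) u := by
  ext x; simp [mem_Ico]

/-- for a threshold `u ∈ [0, 1]` and width `0 ≤ ρ ≤ 1` the shell lies inside `[0,1]` and has toy mass `(1 + Σ²)·uρ`. [folklore] -/
theorem toyLaw_shell (K : ℕ) (a : ℕ → ℝ) {u ρ : ℝ} (hu0 : 0 ≤ u) (hu1 : u ≤ 1) (hρ0 : 0 ≤ ρ) (hρ1 : ρ ≤ 1) :
    (((Real.toNNReal (1 + (∑ i ∈ Finset.range K, a i) ^ 2)) • (volume.restrict (Icc (0 : ℝ) 1)))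
        {x : ℝ | u * (1 - ρ) ≤ x ∧ x < u}).toReal = (1 + (∑ i ∈ Finset.range K, a i) ^ 2) * (u * ρ) := by
  have hsub : Ico (u * (1 - ρ)) u ⊆ Icc (0 : ℝ) 1 := fun x hx =>
    ⟨le_trans (by nlinarith) hx.1, le_trans hx.2.le hu1⟩
  rw [shell_eq_Ico, toyLaw_apply K a measurableSet_Ico, inter_eq_self_of_subset_left hsub, Real.volume_Ico,
    ENNReal.toReal_mul, ENNReal.toReal_ofReal (by positivity), ENNReal.toReal_ofReal (by nlinarith)]
  ring

end ToyLaw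

/-! ## §2 The guard -/

/-- **ROW A″'s BINDER PACKAGE IS INHABITED NON-DEGENERATELY AND THE SELECTED-THRESHOLD KNIT FIRES.**  There are an assignment-dependent family of finite slot laws `ν K a`
on `ℝ` (one slot `()` per comparison, at the top level `K`; both runs read the same slot), threshold-parametric sharp letters `A`, `sh`, `piece` (one term `()`), and an
assignment `a K` per comparison such that: (i) the law of comparison `1` at the older threshold `a₀ = ½` DIFFERS from the one at `a₀ = 1` — the dependence on older
thresholds is REAL — while `ν K` reads only the levels `< K` (`hdep`); (ii) at EVERY assignment in the admissible box `[½, 1]^ℕ` the weights and the SHELL PARTS are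
POSITIVE (no flat witness, A2); (iii) every `a K j` is admissible and road I's conclusion holds AT THE SHARP CARRIERS READ AT `a`:
`ShellWeightBound 1 T (A·(a·)) (A·(a·)) (sh·(a·)) (sh·(a·)) (K ↦ C·(½)^K)` with `C > 0` — the output of 18b's `shellWeightBound_geometric_of_selectedThresholds` on the toy
(windows `[½, 1]`, widths `ρ_j = (½)^j∕4 ≤ ½`, rate `(¼)(½)^j`, `F̄ = 1`, `κ_min = ½`, losses `M₁ = 2`, `M₂ = 1`, live window depth `0`, one slot per level). [folklore] -/
theorem selectedThresholds_fires :
    ∃ (ν : ℕ → (ℕ → ℝ) → Unit → Measure ℝ) (A sh : ℕ → (ℕ → ℝ) → ℝ → Unit → ℝ) (piece : ℕ → (ℕ → ℝ) → ℝ → Unit → Unit → ℝ)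
      (a : ℕ → ℕ → ℝ),
      -- (i) older-measurable, and GENUINELY dependent on the older thresholds
      (∀ (K : ℕ) (a b : ℕ → ℝ), (∀ i, i < K → a i = b i) → ν K a () = ν K b ()) ∧
      ν 1 (fun _ => 1 / 2) () ≠ ν 1 (fun _ => 1) () ∧
      -- (ii) non-degenerate at EVERY admissible assignment: positive weights, POSITIVE shell parts, shell part = the slot's piece
      (∀ (K : ℕ) (b : ℕ → ℝ) (t : ℝ), (∀ j, b j ∈ Icc ((1 - (1 / 2 : ℝ)) * 1) 1) →
        0 < A K b t () ∧ 0 < sh K b t () ∧ sh K b t () = piece K b t () ()) ∧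
      -- (iii) the selection: admissible, and the knit FIRES at the sharp carriers read at `a`
      (∀ K j, a K j ∈ Icc ((1 - (1 / 2 : ℝ)) * 1) 1) ∧
      ∃ C : ℝ, 0 < C ∧
        ShellWeightBound 1 T (fun K => A K (a K)) (fun K => A K (a K)) (fun K => sh K (a K)) (fun K => sh K (a K)) fun K => C * (1 / 2 : ℝ) ^ K := by
  classical
  -- the toy letters
  let ρ : ℕ → ℝ := fun j => (1 / 4 : ℝ) * (1 / 2 : ℝ) ^ j
  let ν : ℕ → (ℕ → ℝ) → Unit → Measure ℝ := fun K a _ =>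
    (Real.toNNReal (1 + (∑ i ∈ Finset.range K, a i) ^ 2)) • (volume.restrict (Icc (0 : ℝ) 1))
  let A : ℕ → (ℕ → ℝ) → ℝ → Unit → ℝ := fun K a _ _ => 1 * ((ν K a ()) univ).toReal
  let piece : ℕ → (ℕ → ℝ) → ℝ → Unit → Unit → ℝ := fun K a _ _ _ =>
    2 * ((ν K a ()) {x : ℝ | a K * (1 - ρ K) ≤ x ∧ x < a K}).toReal
  let sh : ℕ → (ℕ → ℝ) → ℝ → Unit → ℝ := fun K a t _ => piece K a t () ()
  have hρ0 : ∀ j, 0 < ρ j := fun j => by positivity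
  have hρ4 : ∀ j, ρ j ≤ 1 / 4 := fun j => by
    show (1 / 4 : ℝ) * (1 / 2 : ℝ) ^ j ≤ 1 / 4
    have : (1 / 2 : ℝ) ^ j ≤ 1 := pow_le_one₀ (by norm_num) (by norm_num)
    linarith
  -- the two toy computations at an admissible assignment
  have hA_eq : ∀ (K : ℕ) (b : ℕ → ℝ) (t : ℝ), A K b t () = 1 + (∑ i ∈ Finset.range K, b i) ^ 2 := fun K b t => by
    show 1 * ((ν K b ()) univ).toReal = _
    rw [one_mul]; exact toyLaw_univ K b
  have hpiece_eq : ∀ (K : ℕ) (b : ℕ → ℝ) (t : ℝ), (∀ j, b j ∈ Icc ((1 - (1 / 2 : ℝ)) * 1) 1) →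
      piece K b t () () = 2 * ((1 + (∑ i ∈ Finset.range K, b i) ^ 2) * (b K * ρ K)) := fun K b t hb => by
    have hbK := hb K
    show 2 * ((ν K b ()) {x : ℝ | b K * (1 - ρ K) ≤ x ∧ x < b K}).toReal = _
    rw [toyLaw_shell K b (by linarith [hbK.1]) hbK.2 (hρ0 K).le (by linarith [hρ4 K])]
  have hfin : ∀ (K : ℕ) (b : ℕ → ℝ), IsFiniteMeasure (ν K b ()) := fun K b => by
    show IsFiniteMeasure ((Real.toNNReal _) • (volume.restrict (Icc (0 : ℝ) 1)))
    infer_instance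
  -- (ii) positivity at every admissible assignment
  have hpos : ∀ (K : ℕ) (b : ℕ → ℝ) (t : ℝ), (∀ j, b j ∈ Icc ((1 - (1 / 2 : ℝ)) * 1) 1) →
      0 < A K b t () ∧ 0 < sh K b t () ∧ sh K b t () = piece K b t () () := fun K b t hb => by
    have hbK := hb K
    refine ⟨by rw [hA_eq K b t]; positivity, ?_, rfl⟩
    show 0 < piece K b t () ()
    rw [hpiece_eq K b t hb]
    have : 0 < b K := by linarith [hbK.1]
    have := hρ0 K
    positivity
  -- (iii) 18b on the toy
  obtain ⟨a, hadm, hSh⟩ := shellWeightBound_geometric_of_selectedThresholds (ι := Unit) (σ := Unit) (X := fun _ _ => ℝ)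
    (SA := S) (SB := S) (lvl := lvl) (ν := ν) (w := fun _ _ x => x) (θ := fun _ => 1) (κ := fun _ => 1 / 2) (ρ := ρ) (Fbar := 1)
    (l₀ := 1) (T := T) (A := A) (shA := sh) (B := A) (shB := sh) (pieceA := piece) (pieceB := piece) (M₁ := 2) (M₂ := 1)
    (N₁ := 0) (νbar := 1) (κmin := 1 / 2) (c₁ := 1 / 4) (ϑ := 1 / 2)
    (fun _ _ => measurable_id) (fun _ => one_pos) (fun _ => ⟨by norm_num, by norm_num⟩)
    (fun j => ⟨(hρ0 j).le, by linarith [hρ4 j]⟩)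
    (fun K _ b b' hbb' => by
      have hbb'' : ∀ i ∈ Finset.range K, b i = b' i := fun i hi =>
        hbb' i (by simpa [lvl] using Finset.mem_range.1 hi)
      show (Real.toNNReal (1 + (∑ i ∈ Finset.range K, b i) ^ 2)) • (volume.restrict (Icc (0 : ℝ) 1))
          = (Real.toNNReal (1 + (∑ i ∈ Finset.range K, b' i) ^ 2)) • (volume.restrict (Icc (0 : ℝ) 1))
      rw [Finset.sum_congr rfl hbb''])
    zero_le_one
    (fun K m => by
      have h : (((S K ∪ S K).filter fun s => lvl K s = m).card : ℕ) ≤ 1 :=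
        (Finset.card_le_card (Finset.filter_subset _ _)).trans (by simp [S])
      exact_mod_cast h)
    (by norm_num) one_pos
    (fun K b hb t _ τ _ => by
      obtain ⟨hApos, hshpos, hsheq⟩ := hpos K b t hb
      refine ⟨hshpos.le, ?_, by simp [S, sh]⟩
      -- `sh ≤ A`: `2(1+Σ²)·b_K ρ_K ≤ 1 + Σ²` since `b_K ≤ 1`, `ρ_K ≤ ¼`
      rw [hsheq, hpiece_eq K b t hb, hA_eq K b t]
      have h1 : b K * ρ K ≤ 1 * (1 / 4) := mul_le_mul (hb K).2 (hρ4 K) (hρ0 K).le zero_le_one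
      have h2 : 0 ≤ 1 + (∑ i ∈ Finset.range K, b i) ^ 2 := by positivity
      nlinarith)
    (fun K b _ t _ s _ => by simp only [T, Finset.sum_singleton]; exact le_of_eq (by simp [lvl, piece]))
    (fun K b _ t _ s _ => by simp only [T, Finset.sum_singleton]; exact le_rfl)
    (fun K b hb t _ τ _ => by
      obtain ⟨hApos, hshpos, hsheq⟩ := hpos K b t hb
      refine ⟨hshpos.le, ?_, by simp [S, sh]⟩
      rw [hsheq, hpiece_eq K b t hb, hA_eq K b t]
      have h1 : b K * ρ K ≤ 1 * (1 / 4) := mul_le_mul (hb K).2 (hρ4 K) (hρ0 K).le zero_le_one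
      have h2 : 0 ≤ 1 + (∑ i ∈ Finset.range K, b i) ^ 2 := by positivity
      nlinarith)
    (fun K b _ t _ s _ => by simp only [T, Finset.sum_singleton]; exact le_of_eq (by simp [lvl, piece]))
    (fun K b _ t _ s _ => by simp only [T, Finset.sum_singleton]; exact le_rfl)
    liveWindow liveWindow (by norm_num) (fun _ => le_rfl) (fun j => by linarith [hρ4 j])
    (by norm_num) (by norm_num) (fun _ => le_rfl)
  refine ⟨ν, A, sh, piece, a, ?_, ?_, hpos, hadm, _, ?_, hSh⟩
  · -- (i) older-measurability
    intro K b b' hbb'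
    show (Real.toNNReal (1 + (∑ i ∈ Finset.range K, b i) ^ 2)) • (volume.restrict (Icc (0 : ℝ) 1))
        = (Real.toNNReal (1 + (∑ i ∈ Finset.range K, b' i) ^ 2)) • (volume.restrict (Icc (0 : ℝ) 1))
    rw [Finset.sum_congr rfl fun i hi => hbb' i (Finset.mem_range.1 hi)]
  · -- (i) … and the dependence is real: total masses `5∕4 ≠ 2`
    intro h
    have h1 := toyLaw_univ 1 (fun _ => (1 / 2 : ℝ))
    have h2 := toyLaw_univ 1 (fun _ => (1 : ℝ))
    have h12 : (((ν 1 (fun _ => 1 / 2) ()) univ).toReal) = ((ν 1 (fun _ => 1) ()) univ).toReal := by rw [h]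
    change (((Real.toNNReal (1 + (∑ i ∈ Finset.range 1, (fun _ => (1 / 2 : ℝ)) i) ^ 2)) •
        (volume.restrict (Icc (0 : ℝ) 1))) univ).toReal
      = (((Real.toNNReal (1 + (∑ i ∈ Finset.range 1, (fun _ => (1 : ℝ)) i) ^ 2)) •
        (volume.restrict (Icc (0 : ℝ) 1))) univ).toReal at h12
    rw [h1, h2] at h12
    norm_num at h12
  · -- the weight constant is positive
    norm_num

end Summit.QuantumFields.YangMills.Theorems.N21SelectedThresholdsSanity

end
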